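import Mathlib
import HarnessLib
import HarnessLib.Audit
import Summits.PneNP.Statement
import Literature.Computability.Complexity.Promise
import Literature.Computability.Complexity.KarpProblems
import Literature.Computability.Complexity.GraphEncodings
import Literature.Computability.Complexity.ClayProblem
import Literature.Computability.Complexity.ClayProblemProofs
import Literature.Computability.MetaComplexity.SumOfSquares
import HarnessLib.Audit.Status.Attr

/-!
Route: HeisenbergSparsestCut

DORMANT since 2026-08-23T02:14:31Z (reconciler: no traction for 5.8 d (last activity item-evidence-added at 2026-08-17T05:08:07Z); parked, not closed — `ledger route dormant route-PneNP-HeisenbergSparsestCut --off` to reactivate) — unstaffed, not closed; items shared with open routes are served there. `ledger route dormant <id> --off` reactivates.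

Route PneNP/HeisenbergSparsestCut — "P ≠ NP if non-uniform sparsest cut has no O(1)-approximation;
the Heisenberg group as a Lasserre gap engine" (realises idea card heisenberg-sparsest-cut-sos;
imports sub-Riemannian metric geometry + SOS proof complexity).

THESIS X (it suffices to show). Words: for every constant C ≥ 1 no polynomial-time algorithm
C-approximates NON-UNIFORM SPARSEST CUT (capacities c, demands D on the pairs of an n-point set;
minimise c(δS)/D(δS) over cuts S). Typed as a gap promise problem over the tree's PromiseP: an
instance is ONE ℕ-matrix w on Fin n (capacity of {i<j} = w i j from the upper triangle, demand of
{i<j} = w j i from the lower triangle) plus a threshold a/b; YES = some cut with positive demand has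
cap·b ≤ a·dem; NO_C = every cut with positive demand has C·a·dem < cap·b.
Lean (decl NoConstantApproxSparsestCut, elaborates): ∀ C : ℕ, 1 ≤ C → PromiseProblem.ofEncoding
(encodingNatMatrix.pairBool (encodingNatBool.pairBool encodingNatBool)) {YES} {NO_C} ∉
Literature.Computability.Complexity.PromiseP.
A C-approximation of the optimum puts Gap_C in PromiseP and conversely Gap_C ∈ PromiseP gives a
C(1+ε)-approximation by binary search, so ¬X ⟺ "some constant-factor approximation exists".

ASSEMBLY = DECIDING THEOREM (D-0027 §2.1, rev 2). `closes (hX : X) (hS : SparsestCutDecisionInNP) :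
PneNP` is PROVED in this file: if ¬PneNP then NP Bool ⊆ P Bool, i.e. — through the proved model
bridges P_bool_eq_holds / NP_bool_eq_holds, now used inside the proof instead of assumed —
Nondeterministic.NP ⊆ Classes.P; the YES-language is in NP (support item SparsestCutDecisionInNP,
adapt MaxCutNP.lean), hence in P, and it separates Gap_1 (injectivity of the encoding + disjointness
of YES/NO_1), so Gap_1 ∈ PromiseP — contradicting X at C = 1. The item Assembly :=
SparsestCutDecisionInNP → X → PneNP records the same implication (one line from `closes`). Honest
map of the deduction: what reaches the summit is exactly X + NP-membership; the Heisenberg/SOS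
cruxes (#2, #3, #5) are the fixed-degree Lasserre evidence-and-kill farm for X (necessary conditions
modulo SDP solving, never a proof of X), and #4 (GapSparsestCutNPHard) is the one item that would
upgrade X ⟹ PneNP to X ⟺ PneNP.

TWO-LAYER PLAN (D-0019): cruxes first, glue later. Ranked cruxes: (2)
HeisenbergBoxesAreLasserreMetrics — for every degree d the word metric of the discrete Heisenberg
group on the box B_n is O_d(1)-bi-Lipschitz to a degree-d Booleanity pseudo-cut-metric ρ_E(g,h) =
Ẽ[(x_g − x_h)²] (Lee–Naor's negative-type theorem climbed up the Lasserre hierarchy; with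
Cheeger–Kleiner–Naor it makes Heisenberg boxes Lasserre gap instances of unbounded gap at every
fixed degree); (3) LasserreCutMetricsFarFromL1 — degree-d pseudo-cut-metrics have unbounded
L¹-distortion for every d (= unbounded degree-d Lasserre integrality gap for non-uniform sparsest
cut; necessary for X modulo SDP solving; the Barak–Steurer 'degree 4 vs ARV' question); (4)
GapSparsestCutNPHard — NP-hardness of Gap_C for every C (would make X ⟺ PneNP; known only under
UGC); (5) SosCertifiesHeisenbergDistortion — the negative rung: at some fixed degree SOS derives a
CKN-type (log n)^c distortion lower bound from Booleanity alone ("coarse differentiation IS a sum of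
squares"), refuting crux 2. Supports: SparsestCutDecisionInNP (assembly bookkeeping),
HeisenbergGivesLasserreGaps (crux 2 + CKN ⟹ crux 3, variable renaming only).

Rationale: WHY THIS LINE (areas imported: sub-Riemannian metric geometry / geometric measure theory on the
Heisenberg group; SOS proof complexity). Approximating non-uniform sparsest cut IS the finite
quantitative theory of embedding metrics into L¹: by Linial–London–Rabinovich / Aumann–Rabani
duality (doi:10.1007/bf01200757, doi:10.1137/s0097539794285983) the integrality gap of any
relaxation optimising over a class M of "metrics" equals sup of the L¹-distortion c₁ over M. At
level 1 (Goemans–Linial SDP, M = negative type) the decisive lower bound is a theorem of OUTSIDE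
mathematics: the Heisenberg group is of negative type (Lee–Naor doi:10.1109/focs.2006.47) yet not
bi-Lipschitz in L¹ (Cheeger–Kleiner doi:10.4007/annals.2010.171.1347; quantitatively CKN
arXiv:0910.2024 / arXiv:0910.2026; sharp √log n by the vertical-vs-horizontal isoperimetric
inequality, Naor–Young arXiv:1701.00620; semigroup proof Lafforgue–Naor arXiv:1212.2107). The same
duality holds verbatim at Lasserre degree d with M_d = {ρ_E(i,j) = Ẽ[(x_i−x_j)²] : Ẽ a degree-d
Booleanity pseudoexpectation} (tree: KMOW IsPseudoexpectation/SatisfiesIdentity, arXiv:1701.04521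
Defs 2.7–2.8; relaxation as in Guruswami–Sinop arXiv:1112.4109 §2). So "are Heisenberg balls
Lasserre gap instances?" becomes ONE typed statement — crux 2: d_W on the box B_n is
O_d(1)-equivalent to some ρ_E ∈ M_d — and its negation side is "degree-O(1) SOS proves coarse
non-differentiability" (crux 5). Hypercube gap instances collapse under ≤ 8 rounds precisely because
their soundness proofs (hypercontractivity) ARE low-degree SOS (BBHKSZ arXiv:1205.4484;
O'Donnell–Zhou arXiv:1212.5324); Heisenberg soundness proofs are Rademacher-type differentiation
arguments with no known SOS form — a principled reason to expect new behaviour, and a clean death if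
not. Catalogue moves used: duality/certificate-by-dual-witness (LP duality turns gaps into
embeddings), transplant with explicit dictionary (metric ↦ pseudo-cut-metric, GL ↦ degree d,
Lee–Naor negative type ↦ crux 2, CKN ↦ crux 5's target inequality), negative side staffed.

RANKED CRUXES (decls; each informal carries why-it-might-fail + sources):
#2 HeisenbergBoxesAreLasserreMetrics — engine; two-sided; d ≤ 3 holds by Lee–Naor + Schoenberg, d =
4 first open rung, d = 8 the Khot–Vishnoi benchmark.
#3 LasserreCutMetricsFarFromL1 — unbounded degree-d Lasserre gap ∀ d (Barak–Steurer arXiv:1404.5236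
§3 open question, constant-factor form); necessary for X modulo SDP solving; follows from #2 + CKN
(support HeisenbergGivesLasserreGaps).
#4 GapSparsestCutNPHard — ∀ C, Gap_C NP-hard (CKKRS doi:10.1007/s00037-006-0210-9 and KV
arXiv:1305.4581 give it under UGC only); with it X ⟺ PneNP.
#5 SosCertifiesHeisenbergDistortion — negative rung, ∃ d: SOS-degree-d forces K ≥ c(log n)^c;
natural attack = SOS-ize Lafforgue–Naor; cheapest probes: hypermetric/k-gonal inequalities on B_n
and the degree-4 moment SDP for n ≤ 4 (kit).
Supports: SparsestCutDecisionInNP (adapt MaxCutNP.lean; load-bearing for Assembly),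
HeisenbergGivesLasserreGaps (glue).

KILL CRITERIA. ¬X (any constant-factor approximation, e.g. by Lasserre rounding à la Guruswami–Sinop
on all instances) closes the route and refutes UGC-type hypotheses with it. #5 proved (or #2 refuted
at a fixed degree) kills the ENGINE: the route then keeps only X/#3/#4 and should be merged with the
other approximation-threshold line (card grothendieck-constant-threshold) or closed "no engine". #3
refuted at some degree d₀ (uniform O(1) Lasserre gap) refutes X outright modulo SDP bit-complexity
(Raghavendra–Weitz conditions hold on the cube). An O(1)-approximation for sparsest cut on Cayley
graphs of polynomial growth does NOT kill #2 as typed (duality chooses capacities AND demands on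
B_n), but would redirect kit work.

DELIBERATELY NOT DECOMPOSED YET: the step-s Carnot graded family (distortion exponent increasing in
the nilpotency step — open in GMT itself; future support under #2); uniform-demand and
balanced-separator variants; the quantitative weakening of #2 with K = K(d,n) = o((log n)^δ) (the
fallback restatement if #5 lands with a small exponent); SDP-solvability bookkeeping turning ¬#3
into ¬X; reductions FROM sparsest cut (min-bisection, linear arrangement). No definition requests:
everything is typed inline over Promise.lean, KarpProblems.cutWeight, GraphEncodings and
MetaComplexity.SumOfSquares; a later librarian refactor may name gapSparsestCut / pseudoCutMetric.
SOURCES: doi:10.1007/bf01200757, doi:10.1137/s0097539794285983, arXiv:math/0508154 (ALN upper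
bound), doi:10.1109/focs.2006.47, doi:10.4007/annals.2010.171.1347, arXiv:0910.2024,
arXiv:0910.2026, arXiv:1701.00620, arXiv:1212.2107, arXiv:1205.4484, arXiv:1212.5324,
arXiv:1404.5236, arXiv:1202.6071, arXiv:1112.4109, arXiv:1305.4581, doi:10.1007/s00037-006-0210-9,
doi:10.1137/080729256, arXiv:1701.04521, doi:10.4064/cm95-1-2 (Blachère: exact word metric on ℍ(ℤ)),
AroraBarakCC2009.

Novelty: NOVELTY. Nearest prior art (all found and read/grepped): (A) the level-1 engine is complete in print
— Lee–Naor doi:10.1109/focs.2006.47 (ℍ is negative type), Cheeger–Kleiner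
doi:10.4007/annals.2010.171.1347, Cheeger–Kleiner–Naor arXiv:0910.2024 / arXiv:0910.2026 ((log
n)^Ω(1) GL gap), Naor–Young arXiv:1701.00620 (√log n), Lafforgue–Naor arXiv:1212.2107; (B)
SOS-ization of analytic inequalities and the Lasserre collapse of hypercube gap instances — BBHKSZ
arXiv:1205.4484, O'Donnell–Zhou arXiv:1212.5324; (C) the open problem 'can degree 4, or degree log
n, SOS beat ARV for sparsest cut?' — Barak–Steurer arXiv:1404.5236 §3 p.11; (D) hierarchy gaps for
sparsest cut — Sherali–Adams (CMM doi:10.1145/1536414.1536455), SA+SDP (Raghavendra–Steurer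
doi:10.1109/focs.2009.73), Lasserre only 1+ε at Ω(n) rounds (Guruswami–Sinop–Zhou arXiv:1202.6071).
DELTA: the JOIN of (A) with (B)/(C) — Heisenberg boxes posed as LASSERRE gap instances, typed as the
single primal statement 'the Heisenberg word metric is O_d(1)-equivalent to a degree-d Booleanity
pseudo-cut-metric for every d' (crux HeisenbergBoxesAreLasserreMetrics = Lee–Naor's theorem climbed
up the hierarchy) together with its negation side 'degree-O(1) SOS certifies CKN distortion'
(SosCertifiesHeisenbergDistortion), both phrased through the level-d LLR duality 'degree-d Lasserre
gap on a point set = sup c₁ over degree-d pseudo-cut-metrics on it'; none of the three was found in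
print. Thesis X itself is folklore (the belief behind UGC-  [refs: 10.1109/focs.2006.47, 10.4007/annals.2010.171.1347, 10.1145/1536414.1536455, 10.1109/focs.2009.73, 10.1007/s00037-006-0210-9, 0910.2024, 0910.2026, 1701.00620, 1212.2107, 1205.4484, 1212.5324, 1404.5236, 1202.6071, 1406.7279, 1003.4261, 1704.01200, doi:10.1109/focs.2006.47, doi:10.4007/annals.2010.171.1347, doi:10.1145/1536414.1536455, doi:10.1109/focs.2009.73, doi:10.1007/s00037-006-0210-9]

Barriers (technique_class: sos-integrality-gaps, metric-embeddings, lasserre): technique_class: sos-integrality-gaps, metric-embeddings, lasserre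
- Literature.Barriers.PneNP.Relativization (with Literature.Barriers.PneNP.BoundedRelativization and
Literature.Barriers.PneNP.Algebrization): APPLY to the target X and are relocated, not evaded — the
Assembly relativizes (P^O = NP^O puts Gap_1 in PromiseP^O), so any proof of X must be
non-relativizing and non-algebrizing; the route's only candidate carrier of non-relativizing content
is the PCP machinery under crux GapSparsestCutNPHard (X ⟺ PneNP once it lands). The geometric cruxes
(HeisenbergBoxesAreLasserreMetrics, LasserreCutMetricsFarFromL1, SosCertifiesHeisenbergDistortion)
are unconditional statements about SDP hierarchies and metric spaces, outside the scope of oracle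
barriers (they are not separations).
- Literature.Barriers.PneNP.NaturalProofs — not engaged: no circuit class and no constructive-large
property of truth tables; X is a uniform statement about one optimisation problem.
- Literature.Barriers.PneNP.TSPExtensionComplexity (the catalogue's convex-relaxation entry;
extended-formulation lower bounds): same FAMILY of technique as cruxes 2–3 (lower bounds against
explicit convex relaxations) but it constrains P = NP attempts, not this line; what carries over is
the honest CAPTURE GAP — Lasserre gaps at every fixed degree (crux 3) are evidence for X and a
necessary condition for it, never a proof, because polynomial time is not exhausted by SOS; the
route says so and staffs GapSparsestCutNPHard

Novelty grade: new-combination — ROUTE REVIEW (refuter rreview-ab8e18b7, 2026-08-15; FIRST pass, I stamped 8/8 typed items with briefings). PRECISION: 8/8 elaborate (W2.lean rc0; simp closes no S/¬S). Gap_C faithfully typed; YES∩NO_C=∅ for C≥1 (not overlap-trivial); ℍ Cayley graph connected (dist = word metric). Degree corners (on  (refuter refuter-rreview-route-PneNP-RamseyAliens-ab8e18b7-0, 2026-08-15T12:20:14Z; prior: doi:10.1109/focs.2006.47,doi:10.4007/annals.2010.171.1347,arXiv:0910.2026,arXiv:1701.00620,arXiv:1212.2107,arXiv:1205.4484,ar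Xiv:1212.5324,arXiv:1404.5236,arXiv:1202.6071,doi:10.1109/ccc.2005.20,doi:10.1145/2629614,doi:10.1007/978-3-642-15369-3_23)

History (route lifecycle, newest last):
- 2026-08-15T16:16:54Z · rev 2: restated Assembly (stmt-PneNP-2285) — route-repair (glue, D-0027 §2.1): deciding theorem closes (hX : NoConstantApproxSparsestCut) (hS : SparsestCutDecisionInNP) : _root_.PneNP PROVED outright — ¬Pn (planner-rbadge-PneNP-HeisenbergSparsestCut-b19b200c-g2-0)
- 2026-08-16T04:14:06Z · AUTO-CRUX (backfill): NoConstantApproxSparsestCut — hypotheses of the deciding theorem that nothing in the route derives are cruxes (operator:999:1085951)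
- 2026-08-23T02:14:31Z · DORMANT — reconciler: no traction for 5.8 d (last activity item-evidence-added at 2026-08-17T05:08:07Z); parked, not closed — `ledger route dormant route-PneNP-Heisenberg (operator:999:2949213)

sub-problem: PneNP · status: dormant · opened planner-plancard-PneNP-PneNP-heisenberg-spars-bcb4ba78-0 2026-08-15T11:02:47Z · rev 5 · ledger route-PneNP-HeisenbergSparsestCut
GENERATED by the gate from the ledger (D-0016/17). Provers cite these decls: `theorem foo : Summit.PneNP.PneNP.Theses.HeisenbergSparsestCut.<Decl> := …` in Summits/PneNP/PneNP/Theorems/<Name>.lean.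
-/

namespace Summit.PneNP.PneNP.Theses.HeisenbergSparsestCut

open scoped BigOperators Topology Manifold Classical MeasureTheory ProbabilityTheory Matrix InnerProductSpace ComplexConjugate ContinuousMap
open Filter Set Function TopologicalSpace MeasureTheory

attribute [summit_statement] _root_.PneNP

open Literature.PNP

/-- item stmt-PneNP-2284 · crux (kind.auto-crux: conjecture-grade) · rank 0 · open · by planner
why it might fail: An O(1)-approximation may exist: whether degree-4 (or log n) SOS beats GL/ARV is open (Barak–Steurer arXiv:1404.5236 §3 p.11), GL itself is only now pinned at Θ(√log n) (Chang–Naor–Ren arXiv:2410.21931), and X is implied only by UGC/SSE-type hypotheses, which have subexponential algorithms.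
sources: doi:10.1007/s00037-006-0210-9, arXiv:1305.4581, arXiv:2410.21931, arXiv:1404.5236, arXiv:math/0508154, arXiv:1701.00620
[target] Thesis X of idea card heisenberg-sparsest-cut-sos: NON-UNIFORM SPARSEST CUT has no
polynomial-time constant-factor approximation. Instance: n, one ℕ-matrix w on Fin n (capacity of the
pair {i<j} = w i j, upper triangle; demand of {i<j} = w j i, lower triangle; diagonal unused) and a
threshold a/b given as (a,b) ∈ ℕ×ℕ; cap S = Σ_{i∈S, j∉S} c_ij and dem S = Σ_{i∈S, j∉S} D_ij are
`cutWeight` of the two symmetrised triangles. Gap_C: YES = some cut with dem S > 0 has cap S·b ≤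
a·dem S (sparsity ≤ a/b); NO_C = every cut with dem S > 0 has C·a·dem S < cap S·b (sparsity >
C·a/b); disjoint for C ≥ 1. X := ∀ C ≥ 1, Gap_C ∉ PromiseP (= promiseLift Classes.P, Promise.lean).
Standard equivalence: a poly-time C-approximation of the optimum value decides Gap_C, and Gap_C ∈
PromiseP yields a C(1+ε)-approximation of the value by binary search over thresholds, so ¬X ⟺ 'some
constant-factor approximation exists'. Status: believed; it follows from UGC/SSE-type hypotheses
(Chawla–Krauthgamer–Kumar–Rabani–Sivakumar doi:10.1007/s00037-006-0210-9; Khot–Vishnoi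
arXiv:1305.4581) but asserts no NP-hardness; best algorithm O(√log n · log log n) (Arora–Lee–Naor
arXiv:math/0508154); Goemans–Linial SDP -/
@[route_item "route-PneNP-HeisenbergSparsestCut", crux]
def NoConstantApproxSparsestCut : Prop :=
  ∀ C : ℕ, 1 ≤ C → Literature.Computability.Complexity.PromiseProblem.ofEncoding (Literature.Computability.Complexity.encodingNatMatrix.pairBool (Computability.encodingNatBool.pairBool Computability.encodingNatBool)) {p | ∃ S : Finset (Fin p.1.1), 0 < Literature.Computability.Complexity.cutWeight (fun i j => if i < j then p.1.2 j i else p.1.2 i j) S ∧ Literature.Computability.Complexity.cutWeight (fun i j => if i < j then p.1.2 i j else p.1.2 j i) S * p.2.2 ≤ p.2.1 * Literature.Computability.Complexity.cutWeight (fun i j => if i < j then p.1.2 j i else p.1.2 i j) S} {p | ∀ S : Finset (Fin p.1.1), 0 < Literature.Computability.Complexity.cutWeight (fun i j => if i < j then p.1.2 j i else p.1.2 i j) S → C * p.2.1 * Literature.Computability.Complexity.cutWeight (fun i j => if i < j then p.1.2 j i else p.1.2 i j) S < Literature.Computability.Complexity.cutWeight (fun i j => if i < j then p.1.2 i j else p.1.2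 j i) S * p.2.2} ∉ Literature.Computability.Complexity.PromiseP

/-- item stmt-PneNP-2286 · crux · rank 2 · open · by planner
why it might fail: Content starts at d=4 (d≤3 holds by Lee–Naor negative type + Schoenberg): a PSD degree-2 moment matrix demands more than negative type + triangle inequality; if Lafforgue–Naor's semigroup proof of the vertical Poincaré inequality SOS-izes at fixed degree (as hypercontractivity did), K ≥ c(log n)^c.
sources: doi:10.1109/focs.2006.47, arXiv:1212.2107, arXiv:0910.2026, arXiv:1701.00620, arXiv:1205.4484, arXiv:1212.5324
[crux] ENGINE of the card ('is coarse differentiation a sum of squares?', primal form). ℍ(ℤ) = ℤ³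
with (x,y,z)(x',y',z') = (x+x', y+y', z+z'+xy'); Cayley graph for the right generators a = (1,0,0),
b = (0,1,0) (SimpleGraph.fromRel symmetrises: g ~ ga^{±1}, gb^{±1}), d_W = graph distance
(left-invariant word metric; exact formula in Blachère doi:10.4064/cm95-1-2); box B_n = {|x| ≤ n,
|y| ≤ n, |z| ≤ n²}, comparable to balls: B_W(n) ⊆ B_n ⊆ B_W(11n). CLAIM: ∀ d ∃ K ∀ n there are a
scale s > 0 and a degree-d pseudoexpectation Ẽ (tree: KMOW Def 2.7 — Ẽ1 = 1, Ẽp² ≥ 0 for 2 deg p ≤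
d; arXiv:1701.04521) satisfying Booleanity x_i² = x_i (SatisfiesIdentity), whose pseudo-cut-metric
ρ(g,h) = Ẽ[(x_g − x_h)²] is K-bi-Lipschitz to s·d_W on B_n (variables indexed through any injection
v : ℤ³ → ℕ). MEANING: the ρ's are exactly the feasible 'metrics' of the (homogenised) degree-d
Lasserre relaxation of non-uniform sparsest cut (Guruswami–Sinop arXiv:1112.4109 §2; degree ≥ 4
already implies the ℓ₂²-triangle inequalities of ARV/GL), so by Linial–London–Rabinovich /
Aumann–Rabani LP duality applied at level d (doi:10.1007/bf01200757, doi:10.1137/s0097539794285983: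
sup over instances on a point set of -/
@[route_item "route-PneNP-HeisenbergSparsestCut"]
def HeisenbergBoxesAreLasserreMetrics : Prop :=
  ∀ d : ℕ, ∃ K : ℝ, ∀ n : ℕ, ∃ (v : ℤ × ℤ × ℤ → ℕ) (E : MvPolynomial ℕ ℝ →ₗ[ℝ] ℝ) (s : ℝ), Function.Injective v ∧ 0 < s ∧ Literature.Computability.MetaComplexity.IsPseudoexpectation d E ∧ (∀ i : ℕ, Literature.Computability.MetaComplexity.SatisfiesIdentity d E (Literature.Computability.MetaComplexity.boolAxiom i)) ∧ ∀ g h : ℤ × ℤ × ℤ, |g.1| ≤ n → |g.2.1| ≤ n → |g.2.2| ≤ n ^ 2 → |h.1| ≤ n → |h.2.1| ≤ n → |h.2.2| ≤ n ^ 2 → s * ((SimpleGraph.fromRel fun a b : ℤ × ℤ × ℤ => b = (a.1 + 1, a.2.1, a.2.2) ∨ b = (a.1, a.2.1 + 1, a.2.2 + a.1)).dist g h : ℝ) ≤ E ((MvPolynomial.X (v g) - MvPolynomial.X (v h)) ^ 2) ∧ E ((MvPolynomial.X (v g) - MvPolynomial.X (v h)) ^ 2) ≤ K * s * ((SimpleGraph.fromRel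 fun a b : ℤ × ℤ × ℤ => b = (a.1 + 1, a.2.1, a.2.2) ∨ b = (a.1, a.2.1 + 1, a.2.2 + a.1)).dist g h : ℝ)

/-- item stmt-PneNP-2287 · crux · rank 3 · open · by planner
why it might fail: Constant-degree SOS may O(1)-approximate non-uniform sparsest cut: no super-constant Lasserre gap is known at ANY fixed degree ≥ 4 (GL: Θ(√log n), arXiv:1701.00620/2410.21931; Lasserre: only 1+ε at Ω(n) rounds, arXiv:1202.6071), and Barak–Steurer arXiv:1404.5236 §3 leave even degree 4 open.
sources: arXiv:1404.5236, arXiv:1202.6071, arXiv:1701.00620, arXiv:2410.21931, arXiv:0910.2024, doi:10.1109/focs.2009.73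
[crux] For every degree d and every D there is a finite degree-d pseudo-cut-metric ρ(i,j) = Ẽ[(x_i −
x_j)²] on {0,…,m−1} (Ẽ a degree-d pseudoexpectation with Booleanity, KMOW Defs 2.7–2.8,
arXiv:1701.04521) admitting NO D-bi-Lipschitz embedding into ℓ₁ (targets ℓ₁^N, N arbitrary = the cut
cone for finite sets; i.e. c₁(ρ) > D). By LLR/AR duality at level d (doi:10.1007/bf01200757,
doi:10.1137/s0097539794285983; the level-1 proof goes through verbatim since pseudo-cut-metrics form
a convex cone after scaling) this is EXACTLY 'for every fixed d the degree-d Lasserre/SOS relaxation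
of non-uniform sparsest cut has unbounded integrality gap' — the constant-factor form of the
Barak–Steurer question 'can degree 4, or degree log n, proofs beat ARV?' (arXiv:1404.5236 §3, p.11:
'We don't know the answer'). NECESSARY for X modulo SDP solvability: a degree-d₀ relaxation with gap
≤ C uniformly, solved to accuracy in time n^{O(d₀)} (Booleanity constraints satisfy the
Raghavendra–Weitz bit-complexity conditions), C(1+ε)-approximates the value and refutes X. STATE OF
THE ART: level 1 (GL) gap ≥ c√log n (Naor–Young arXiv:1701.00620; CKN arXiv:0910.2024; Khot–Vishnoi
arXiv:1305.4581 and Devanur–Khot– -/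
@[route_item "route-PneNP-HeisenbergSparsestCut"]
def LasserreCutMetricsFarFromL1 : Prop :=
  ∀ (d : ℕ) (D : ℝ), ∃ (m : ℕ) (E : MvPolynomial ℕ ℝ →ₗ[ℝ] ℝ), Literature.Computability.MetaComplexity.IsPseudoexpectation d E ∧ (∀ i : ℕ, Literature.Computability.MetaComplexity.SatisfiesIdentity d E (Literature.Computability.MetaComplexity.boolAxiom i)) ∧ ¬ ∃ (N : ℕ) (f : Fin m → Fin N → ℝ), ∀ i j : Fin m, E ((MvPolynomial.X (i : ℕ) - MvPolynomial.X (j : ℕ)) ^ 2) ≤ ∑ k, |f i k - f j k| ∧ ∑ k, |f i k - f j k| ≤ D * E ((MvPolynomial.X (i : ℕ) - MvPolynomial.X (j : ℕ)) ^ 2)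

/-- item stmt-PneNP-2288 · crux · rank 4 · open · by planner
why it might fail: Unconditional NP-hardness stops at 17/16−ε (Gupta–Talwar–Witmer arXiv:1305.1347 Thm 1.3, via Chuzhoy–Khanna), so only C=1 is known; every natural C ≥ 2 is known under UGC alone (CKKRS, Khot–Vishnoi), needs long-code-free PCPs nobody has, and is false outright if any O(1)-approximation exists.
sources: arXiv:1305.1347, doi:10.1007/s00037-006-0210-9, arXiv:1305.4581, doi:10.1137/080729256, AroraBarakCC2009
[crux] For every C ≥ 1 the gap promise problem Gap_C of the target (same YES/NO_C sets, same
encoding) is NP-hard under polynomial-time promise Karp reductions (PromiseProblem.IsNPHard,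
Promise.lean). With it X ⟺ P ≠ NP (NP_subset_P_of_isNPHard_of_mem_PromiseP), upgrading the route
from a sufficient condition to an equivalent one; without it X stays strictly stronger than PneNP.
STATUS: OPEN. Known under the Unique Games Conjecture for every constant
(Chawla–Krauthgamer–Kumar–Rabani–Sivakumar doi:10.1007/s00037-006-0210-9; Khot–Vishnoi
arXiv:1305.4581) — it is the sparsest-cut face of the UGC / 2-to-2 frontier. Unconditionally: exact
non-uniform sparsest cut is NP-hard; the UNIFORM version has no PTAS unless NP ⊆ ∩_ε BPTIME(2^{n^ε})
(Ambühl–Mastrolilli–Svensson doi:10.1137/080729256); APX-hardness of the non-uniform version without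
UGC is not known to the planner (grounder: confirm or cite). A proof must run PCP machinery (tree:
pcp_theorem_exact, hastad-type facts in Approximation.lean) plus a new outer verifier /
long-code-free gadget; this is where the route's non-relativizing content would live. Refuter's
first test (LatticeGapCoNP analogue): is Gap_C in PromiseCoNP for some co -/
@[route_item "route-PneNP-HeisenbergSparsestCut"]
def GapSparsestCutNPHard : Prop :=
  ∀ C : ℕ, 1 ≤ C → (Literature.Computability.Complexity.PromiseProblem.ofEncoding (Literature.Computability.Complexity.encodingNatMatrix.pairBool (Computability.encodingNatBool.pairBool Computability.encodingNatBool)) {p | ∃ S : Finset (Fin p.1.1), 0 < Literature.Computability.Complexity.cutWeight (fun i j => if i < j then p.1.2 j i else p.1.2 i j) S ∧ Literature.Computability.Complexity.cutWeight (fun i j => if i < j then p.1.2 i j else p.1.2 j i) S * p.2.2 ≤ p.2.1 * Literature.Computability.Complexity.cutWeight (fun i j => if i < j then p.1.2 j i else p.1.2 i j) S} {p | ∀ S : Finset (Fin p.1.1), 0 < Literature.Computability.Complexity.cutWeight (fun i j => if i < j then p.1.2 j i else p.1.2 i j) S → C * p.2.1 * Literature.Computability.Complexity.cutWeight (fun i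 j => if i < j then p.1.2 j i else p.1.2 i j) S < Literature.Computability.Complexity.cutWeight (fun i j => if i < j then p.1.2 i j else p.1.2 j i) S * p.2.2}).IsNPHard

/-- item stmt-PneNP-2289 · crux · rank 5 · open · by planner
why it might fail: All proofs of Heisenberg non-embeddability in L¹ (Cheeger–Kleiner differentiation, CKN, Naor–Young foliated corona, Lafforgue–Naor square functions) use density points/blow-ups or semigroup estimates with no known fixed-degree SOS form; degree may have to grow with n — the rank-2 crux may be true.
sources: arXiv:1212.2107, arXiv:0910.2026, arXiv:1701.00620, doi:10.4007/annals.2010.171.1347, arXiv:1212.5324, arXiv:1205.4484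
[crux] NEGATIVE RUNG ('coarse differentiation IS a sum of squares'): there are a fixed degree d and
c > 0 such that for every n ≥ 2, every degree-d Booleanity pseudoexpectation whose pseudo-cut-metric
Ẽ[(x_g − x_h)²] is K-bi-Lipschitz to s·d_W on the Heisenberg box B_n (same graph, box and
conventions as HeisenbergBoxesAreLasserreMetrics) has K ≥ c(log n)^c — i.e. degree-d SOS DERIVES a
Cheeger–Kleiner–Naor-type quantitative non-embeddability (arXiv:0910.2026 Thm 1.1: c₁ of the n-ball
≥ (log n)^δ; sharp exponent 1/2 up to lower-order terms by the vertical-versus-horizontal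
isoperimetric inequality, Naor–Young arXiv:1701.00620) from Booleanity alone. Implies
¬HeisenbergBoxesAreLasserreMetrics and kills the card's engine (the route then keeps only X /
LasserreCutMetricsFarFromL1 / GapSparsestCutNPHard). NATURAL ATTACK = the card's fastest refutation:
SOS-ize the semigroup proof of the vertical-versus-horizontal Poincaré inequality on ℍ
(Lafforgue–Naor arXiv:1212.2107) or the Austin–Naor–Tessera martingale / Littlewood–Paley argument,
the way hypercontractivity and small-set expansion on the cube were SOS-ized at degree 4
(O'Donnell–Zhou arXiv:1212.5324; Barak et al. arXiv:1205.4484). -/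
@[route_item "route-PneNP-HeisenbergSparsestCut"]
def SosCertifiesHeisenbergDistortion : Prop :=
  ∃ (d : ℕ) (c : ℝ), 0 < c ∧ ∀ n : ℕ, 2 ≤ n → ∀ (v : ℤ × ℤ × ℤ → ℕ) (E : MvPolynomial ℕ ℝ →ₗ[ℝ] ℝ) (s K : ℝ), Function.Injective v → 0 < s → Literature.Computability.MetaComplexity.IsPseudoexpectation d E → (∀ i : ℕ, Literature.Computability.MetaComplexity.SatisfiesIdentity d E (Literature.Computability.MetaComplexity.boolAxiom i)) → (∀ g h : ℤ × ℤ × ℤ, |g.1| ≤ n → |g.2.1| ≤ n → |g.2.2| ≤ n ^ 2 → |h.1| ≤ n → |h.2.1| ≤ n → |h.2.2| ≤ n ^ 2 → s * ((SimpleGraph.fromRel fun a b : ℤ × ℤ × ℤ => b = (a.1 + 1, a.2.1, a.2.2) ∨ b = (a.1, a.2.1 + 1, a.2.2 + a.1)).dist g h : ℝ) ≤ E ((MvPolynomial.X (v g) - MvPolynomial.X (v h)) ^ 2) ∧ E ((MvPolynomial.X (v g) - MvPolynomial.X (v h)) ^ 2) ≤ K * s * ((SimpleGraph.fromRel fun a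 b : ℤ × ℤ × ℤ => b = (a.1 + 1, a.2.1, a.2.2) ∨ b = (a.1, a.2.1 + 1, a.2.2 + a.1)).dist g h : ℝ)) → c * Real.log n ^ c ≤ K

/-- item stmt-PneNP-18995 · crux · rank 6 · open · by planner
why it might fail: May fail if the sparsest-cut approximation threshold is met only at Lasserre degree growing with n (Barak–Steurer arXiv:1404.5236 §3: degree 4 vs log n open) or by a non-SOS algorithm; SDP optimality is a theorem only for Max-CSPs under UGC (Raghavendra 2008); P = NP plus crux 2287 refutes it.
sources: doi:10.1145/1374376.1374414, doi:10.1145/2746539.2746599, arXiv:1404.5236, doi:10.1007/bf01200757, doi:10.1137/s0097539794285983, arXiv:1112.4109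
[crux] SOS OPTIMALITY FOR NON-UNIFORM SPARSEST CUT — the route's confessed 'capture gap', now a
named leaf of the decomposition NoConstantApproxSparsestCut ⟸ SosOptimalForSparsestCut ∧
LasserreCutMetricsFarFromL1 (strategist cstrat-stmt-PneNP-2284, BC2 redirect). If Gap_C ∈ PromiseP
for some constant C ≥ 1 (some polynomial-time algorithm O(1)-approximates non-uniform sparsest cut),
then some FIXED degree d of the Lasserre/SOS hierarchy already has integrality ratio ≤ D = O(1) on
EVERY real-weighted instance, in rounding form: for all capacities cap ≥ 0 and demands dem ≥ 0 on
the ordered pairs of Fin m and every degree-d Booleanity pseudoexpectation E (KMOW Defs 2.7–2.8,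
arXiv:1701.04521) with Σ dem·ρ_E > 0, ρ_E(i,j) = Ẽ[(x_i − x_j)²], some cut S with dem(δS) > 0
satisfies cap(δS)·Σ dem ρ_E ≤ D·dem(δS)·Σ cap ρ_E (δS counted on ordered pairs, |𝟙_S(i) − 𝟙_S(j)|).
STATUS: open; WEAKER than X (X ⟹ it vacuously) and not a consequence of PneNP; it is the
sparsest-cut analogue of Raghavendra's UGC-optimality of the basic SDP for Max-CSPs
(doi:10.1145/1374376.1374414) and of the Lee–Raghavendra–Steurer principle that polynomial-size SDP
relaxations are no stronger than low-degree SOS (doi:1 -/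
@[route_item "route-PneNP-HeisenbergSparsestCut"]
def SosOptimalForSparsestCut : Prop :=
  ∀ C : ℕ, 1 ≤ C → Literature.Computability.Complexity.PromiseProblem.ofEncoding (Literature.Computability.Complexity.encodingNatMatrix.pairBool (Computability.encodingNatBool.pairBool Computability.encodingNatBool)) {p | ∃ S : Finset (Fin p.1.1), 0 < Literature.Computability.Complexity.cutWeight (fun i j => if i < j then p.1.2 j i else p.1.2 i j) S ∧ Literature.Computability.Complexity.cutWeight (fun i j => if i < j then p.1.2 i j else p.1.2 j i) S * p.2.2 ≤ p.2.1 * Literature.Computability.Complexity.cutWeight (fun i j => if i < j then p.1.2 j i else p.1.2 i j) S} {p | ∀ S : Finset (Fin p.1.1), 0 < Literature.Computability.Complexity.cutWeight (fun i j => if i < j then p.1.2 j i else p.1.2 i j) S → C * p.2.1 * Literature.Computability.Complexity.cutWeight (fun i j => if i < j then p.1.2 j i else p.1.2 i j) S < Literature.Computability.Complexity.cutWeight (fun i j => if i < j then p.1.2 i j else p.1.2 j i) S * p.2.2} ∈ Literature.Computability.Complexity.PromiseP → ∃ (d : ℕ) (D : ℝ), 0 < D ∧ ∀ (m : ℕ)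 (cap dem : Fin m → Fin m → ℝ), (∀ i j, 0 ≤ cap i j) → (∀ i j, 0 ≤ dem i j) → ∀ E : MvPolynomial ℕ ℝ →ₗ[ℝ] ℝ, Literature.Computability.MetaComplexity.IsPseudoexpectation d E → (∀ i : ℕ, Literature.Computability.MetaComplexity.SatisfiesIdentity d E (Literature.Computability.MetaComplexity.boolAxiom i)) → 0 < ∑ i : Fin m, ∑ j : Fin m, dem i j * E ((MvPolynomial.X (i : ℕ) - MvPolynomial.X (j : ℕ)) ^ 2) → ∃ S : Finset (Fin m), 0 < ∑ i : Fin m, ∑ j : Fin m, dem i j * |(if i ∈ S then (1 : ℝ) else 0) - (if j ∈ S then (1 : ℝ) else 0)| ∧ (∑ i : Fin m, ∑ j : Fin m, cap i j * |(if i ∈ S then (1 : ℝ) else 0) - (if j ∈ S then (1 : ℝ) else 0)|) * (∑ i : Fin m, ∑ j : Fin m, dem i j * E ((MvPolynomial.X (i : ℕ) - MvPolynomial.X (j : ℕ)) ^ 2)) ≤ D * (∑ i : Fin m, ∑ j : Fin m, dem i j * |(if i ∈ S then (1 : ℝ) else 0) - (if j ∈ S then (1 : ℝ) else 0)|) * (∑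 i : Fin m, ∑ j : Fin m, cap i j * E ((MvPolynomial.X (i : ℕ) - MvPolynomial.X (j : ℕ)) ^ 2))

/-- item stmt-PneNP-19070 · support · rank 9 · open · by planner
sources: doi:10.1007/bf01200757, doi:10.1137/s0097539794285983, arXiv:1701.04521
[support · glue of the split of NoConstantApproxSparsestCut] SosOptimalForSparsestCut →
LasserreCutMetricsFarFromL1 → NoConstantApproxSparsestCut. PROVED sorry-free by the strategist
(evidence file HeisenbergSparsestCutNoConstantApproxSparsestCutSplit.lean attached to
stmt-PneNP-2284 and to this item; lean check rc 0, 0 sorries, axioms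
propext/Classical.choice/Quot.sound; theorem
Summit.PneNP.PneNP.Theorems.heisenbergSparsestCut_noConstantApproxSparsestCut_of_subs, ≈ 190 lines)
— a prover lands it VERBATIM under Theorems/ (planners are bounced there:
perm.theorems-prover-only). Content of the seam = the HARD direction of level-d
Linial–London–Rabinovich / Aumann–Rabani LP duality at a fixed fractional solution (Farkas on the
cone spanned by the cut semimetrics and slack directions, tree lemma
Literature.Barriers.PneNP.farkas): given Gap_C ∈ PromiseP, SOS optimality yields a degree d and
ratio bound D valid on every real-weighted instance; the gap crux at degree max d 2 yields a
Booleanity pseudoexpectation on Fin m whose pseudo-cut-metric ρ has no D-embedding into ℓ₁^N; the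
cut-cone alternative then produces capacities/demands ≥ 0 with dem(δS) ≤ cap(δS) for every cut but
D·Σcap ρ < -/
@[route_item "route-PneNP-HeisenbergSparsestCut"]
def NoConstantApproxSparsestCutOfSubs : Prop :=
  SosOptimalForSparsestCut → LasserreCutMetricsFarFromL1 → NoConstantApproxSparsestCut

/-- item stmt-PneNP-2290 · support · rank 9 · closed · proved by Summit.PneNP.PneNP.Theorems.heisenbergSparsestCut_sparsestCutDecisionInNP_proof @ ea0280fb7911 (prover) · by planner
sources: Karp1972, AroraBarakCC2009
[support] The YES-language of the gap problem — encodings (encodingNatMatrix.pairBool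
(encodingNatBool.pairBool encodingNatBool)) of the (⟨n,w⟩,(a,b)) admitting S ⊆ Fin n with dem S > 0
∧ cap S·b ≤ a·dem S, cap/dem = cutWeight of the symmetrised upper/lower triangle of w — lies in
Nondeterministic.NP: certificate = characteristic vector of S (encodingFinsetFin), verifier decodes,
computes the two cut sums and compares the two products in polynomial time. Adapt MaxCutNP.lean
(MAXCUT_mem_NP: code-word test + cut verifier for encodingNatMatrix.pairBool encodingNatBool and
KarpProblems.cutWeight; assembly MAXCUT = codeLang ⊓ witnessLang via inter_P_mem_polyExists).
Routine but laborious machine-level construction; LOAD-BEARING for the Assembly. [sources: Karp1972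
§3 problem 21 conventions as in KarpProblems.lean; MaxCutNP.lean] -/
@[route_item "route-PneNP-HeisenbergSparsestCut", crux]
def SparsestCutDecisionInNP : Prop :=
  (Literature.Computability.Complexity.encodingNatMatrix.pairBool (Computability.encodingNatBool.pairBool Computability.encodingNatBool)).toLanguage {p | ∃ S : Finset (Fin p.1.1), 0 < Literature.Computability.Complexity.cutWeight (fun i j => if i < j then p.1.2 j i else p.1.2 i j) S ∧ Literature.Computability.Complexity.cutWeight (fun i j => if i < j then p.1.2 i j else p.1.2 j i) S * p.2.2 ≤ p.2.1 * Literature.Computability.Complexity.cutWeight (fun i j => if i < j then p.1.2 j i else p.1.2 i j) S} ∈ Literature.Computability.Complexity.Nondeterministic.NP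

/-- item stmt-PneNP-2291 · support · rank 9 · closed · proved by Summit.PneNP.PneNP.Theorems.heisenbergSparsestCut_heisenbergGivesLasserreGaps_proof @ e70f38ec22f9 (prover) · by planner
sources: arXiv:0910.2026, arXiv:0910.2024, doi:10.1007/bf01200757
[support] Glue: HeisenbergBoxesAreLasserreMetrics → (CKN, inlined as a hypothesis in ℓ₁^N form: ∃ c
> 0 ∀ n ≥ 2, every map f : ℤ³ → ℓ₁^N that is D-bi-Lipschitz on (B_n, s·d_W) has D ≥ c(log n)^c —
Cheeger–Kleiner–Naor arXiv:0910.2026 Thm 1.1 / arXiv:0910.2024 for word-metric balls, transferred to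
boxes by B_W(n) ⊆ B_n and monotonicity of c₁; to be vendored later as a named Literature fact, at
which point this item is restated with `(h : Fact)`) → LasserreCutMetricsFarFromL1. Proof: given d,
D, pick n with c(log n)^c > K(d)·D; move the crux-2 pseudoexpectation to variables 0…m−1 along a
bijection B_n ≃ Fin m (MvPolynomial.rename by an injection ℕ → ℕ extending it preserves
IsPseudoexpectation and the Booleanity identities — the only real work); a putative D-embedding of
its pseudo-cut-metric composed with the K-equivalence is a KD-bi-Lipschitz embedding of s·d_W on B_n
into ℓ₁^N, contradicting CKN. Routine. -/
@[route_item "route-PneNP-HeisenbergSparsestCut"]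
def HeisenbergGivesLasserreGaps : Prop :=
  HeisenbergBoxesAreLasserreMetrics → (∃ c : ℝ, 0 < c ∧ ∀ n : ℕ, 2 ≤ n → ∀ (N : ℕ) (f : ℤ × ℤ × ℤ → Fin N → ℝ) (s D : ℝ), 0 < s → (∀ g h : ℤ × ℤ × ℤ, |g.1| ≤ n → |g.2.1| ≤ n → |g.2.2| ≤ n ^ 2 → |h.1| ≤ n → |h.2.1| ≤ n → |h.2.2| ≤ n ^ 2 → s * ((SimpleGraph.fromRel fun a b : ℤ × ℤ × ℤ => b = (a.1 + 1, a.2.1, a.2.2) ∨ b = (a.1, a.2.1 + 1, a.2.2 + a.1)).dist g h : ℝ) ≤ ∑ k, |f g k - f h k| ∧ ∑ k, |f g k - f h k| ≤ D * s * ((SimpleGraph.fromRel fun a b : ℤ × ℤ × ℤ => b = (a.1 + 1, a.2.1, a.2.2) ∨ b = (a.1, a.2.1 + 1, a.2.2 + a.1)).dist g h : ℝ)) → c * Real.log n ^ c ≤ D) → LasserreCutMetricsFarFromL1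

-- earlier Assembly (stmt-PneNP-2285, replaced 2026-08-15T16:16:54Z -> stmt-PneNP-10479): retired by None — Literature.Computability.Complexity.P_bool_eq → Literature.Computability.Complexity.NP_bool_eq → SparsestCutDecisionInNP → NoConstantApproxSparsestCut → PneNP
/-- item stmt-PneNP-10479 · assembly · rank 1 · closed · proved by Summit.PneNP.PneNP.Theorems.heisenbergSparsestCut_assembly_proof @ c93395da820c (prover) · by planner
[assembly] SparsestCutDecisionInNP → NoConstantApproxSparsestCut → PneNP (the proved model bridges
P_bool_eq / NP_bool_eq are no longer hypotheses: P_bool_eq_holds, NP_bool_eq_holds are used inside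
the proof). This is exactly what the deciding theorem `closes` of this file proves (¬PneNP ⇒ NP ⊆ P
⇒ the YES-language, in NP by SparsestCutDecisionInNP, is in P and separates Gap_1 since YES ∩ NO_1 =
∅ ⇒ Gap_1 ∈ PromiseP, contradicting X at C = 1); a prover closes this item in one line from `closes`
(fun hS hX => closes hX hS). [sources: Cook1971 via Statement.lean; Goldreich2006 Def 1.2 as cited
in Promise.lean] -/
@[route_item "route-PneNP-HeisenbergSparsestCut"]
def Assembly : Prop :=
  SparsestCutDecisionInNP → NoConstantApproxSparsestCut → PneNP

/-! D-0027 §2.1 — DECIDING THEOREM (planner-authored via `route open/edit --closes-file`; by planner-rbadge-PneNP-HeisenbergSparsestCut-b19b200c-g2-0 2026-08-15T16:16:54Z):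
its hypotheses are this route's items and its conclusion the sub-problem Statement (glue_lint), and it elaborates with this file. -/

@[closes "route-PneNP-HeisenbergSparsestCut"] theorem closes (hX : NoConstantApproxSparsestCut) (hS : SparsestCutDecisionInNP) : _root_.PneNP := by
  by_contra h
  have hP : Literature.Computability.Complexity.PNPWave0.P Bool = Literature.Computability.Complexity.Classes.P :=
    Literature.Computability.Complexity.P_bool_eq_holds
  have hN : Literature.Computability.Complexity.PNPWave0.NP Bool = Literature.Computability.Complexity.Nondeterministic.NP :=
    Literature.Computability.Complexity.NP_bool_eq_holds
  have hsub : Literature.Computability.Complexity.Nondeterministic.NP ⊆ Literature.Computability.Complexity.Classes.P := by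
    intro L hL
    by_contra hL'
    exact h ⟨L, hN ▸ hL, hP ▸ hL'⟩
  apply hX 1 le_rfl
  refine Literature.Computability.Complexity.mem_promiseLift_iff.2 ⟨_, hsub hS, le_rfl, ?_⟩
  refine le_compl_iff_disjoint_left.2 (Literature.Computability.Complexity.PromiseProblem.disjoint_ofEncoding _ ?_)
  rw [Set.disjoint_left]
  rintro p ⟨S, hd, hle⟩ hp
  have hlt := hp S hd
  rw [one_mul] at hlt
  exact lt_irrefl _ (lt_of_lt_of_le hlt hle)

end Summit.PneNP.PneNP.Theses.HeisenbergSparsestCut
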